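import Mathlib
import Summits.Ventures.HodgeRepro.Tier4.Common.ConcreteCocompact
import Summits.Ventures.HodgeRepro.Tier4.Line1.CMQuadData

/-!
# Tier4/Line1/DistinguishedPlace — the distinguished real place `w₀ = τ₀|_{E⁺}` of the target as a real embedding of
`E⁺`, and the CM seesaw plane DEFINITE AT `w₀` (Liu 2021 Lemma D.2(2), the costume's clause «definite at
`w₀ = τ₀|_{E′⁺}`») from line scalars of one sign at `τ₀`

Blind re-derivation cell `pub-hodge-repro`, Tier 4 (README §9–§10), seat t4-L1-p3 (gen 2).  Target tree path
`lean/Summits/Ventures/HodgeRepro/Tier4/Line1/DistinguishedPlace.lean`.  Imports typer-1's `Common.TargetData`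
(`TargetData.τ₀`, the distinguished embedding of `P_T4`) and this seat's `Line1.CMQuadData`
(`isDefinite_isGenuineRow_ofLinesRow_cmQuad`).  Mathlib: `NumberField.mem_maximalRealSubfield_iff`,
`NumberField.ComplexEmbedding.IsReal.embedding`.

WHAT THIS IS.  The costume `line1_realise` (Skeleton L1226) takes the seesaw plane «definite at `w₀ = τ₀|_{E′⁺}`».
`isDefinite_isGenuineRow_ofLinesRow_cmQuad` (CMQuadData) is stated at an arbitrary real embedding `σ` of `E⁺`; this
file supplies the one of the target: every complex embedding `τ` of the CM field restricts to a REAL embedding of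
`E⁺` (`realEmbeddingOfComplex τ : E⁺ →+* ℝ`, with `(realEmbeddingOfComplex τ x : ℂ) = τ x`), and for a datum `d` of
`P_T4` the distinguished place is `targetRealPlace d := realEmbeddingOfComplex d.τ₀`; the plane `⟨a⟩ ⊕ ⟨b⟩` is then definite
at `w₀` when `τ₀(a)`, `τ₀(b)` are real of one sign (`isDefinite_isGenuineRow_ofLinesRow_cmQuad_at_τ₀`).  WHICH `a, b`
(the hermitian forms of the two lines of the seesaw) are Liu's remains the free identification.
Nothing here says anything about the status of the Hodge conjecture for CM abelian varieties, which is NOT proved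
(HC_CM is NOT proved by anyone in this repository).
-/

set_option autoImplicit false

noncomputable section

namespace Summit.Ventures.HodgeRepro.Tier4.Line1

open NumberField Common

section RealPlace

variable {E : Type} [Field E]

/-- A complex embedding of the CM field restricts to a real-valued embedding of `E⁺` (every element of the maximal
real subfield has real image under every complex embedding). -/
theorem isReal_comp_subtype (τ : E →+* ℂ) :
    ComplexEmbedding.IsReal (τ.comp (maximalRealSubfield E).subtype) := by
  rw [ComplexEmbedding.isReal_iff]
  ext x
  show (starRingEnd ℂ) (τ x) = τ x
  exact (mem_maximalRealSubfield_iff (K := E) x).mp x.2 τ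

/-- **The real embedding `τ|_{E⁺}` of `E⁺`** cut out by a complex embedding `τ` of the CM field. -/
def realEmbeddingOfComplex (τ : E →+* ℂ) : maximalRealSubfield E →+* ℝ :=
  (isReal_comp_subtype τ).embedding

/-- `realEmbeddingOfComplex τ` agrees with `τ` on `E⁺`. -/
theorem coe_realEmbeddingOfComplex (τ : E →+* ℂ) (x : maximalRealSubfield E) :
    (realEmbeddingOfComplex τ x : ℂ) = τ x :=
  ComplexEmbedding.IsReal.coe_embedding_apply (isReal_comp_subtype τ) x

/-- `realEmbeddingOfComplex τ x` is the real part of `τ x`. -/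
theorem realEmbeddingOfComplex_apply (τ : E →+* ℂ) (x : maximalRealSubfield E) :
    realEmbeddingOfComplex τ x = (τ x).re := by
  have := coe_realEmbeddingOfComplex τ x
  rw [← this, Complex.ofReal_re]

variable [NumberField E] [IsCMField E]

/-- **The CM seesaw plane is definite at the distinguished real place** `w₀ = τ₀|_{E⁺}` when the two line scalars
have real images of one sign under `τ₀` (and genuine). -/
theorem isDefinite_isGenuineRow_ofLinesRow_cmQuad_at (τ₀ : E →+* ℂ) (ω : E) (hω : ω ≠ 0)
    (h : IsCMField.complexConj E ω = -ω) (a b : maximalRealSubfield E) (ha : a ≠ 0) (hb : b ≠ 0)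
    (hpos : (0 < (τ₀ a).re ∧ 0 < (τ₀ b).re) ∨ ((τ₀ a).re < 0 ∧ (τ₀ b).re < 0)) :
    IsDefinite (PlaneData.ofLinesRow (cmQuad ω h) a b 1) ∧ IsGenuineRow (PlaneData.ofLinesRow (cmQuad ω h) a b 1) :=
  isDefinite_isGenuineRow_ofLinesRow_cmQuad ω hω h a b ha hb (realEmbeddingOfComplex τ₀)
    (by simpa only [realEmbeddingOfComplex_apply] using hpos)

end RealPlace

section Target

variable {F E : Type} [Field F] [NumberField F] [IsGalois ℚ F] [IsCMField F]
  [Field E] [NumberField E] [IsGalois ℚ E] [IsCMField E]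

/-- **The distinguished real place of a datum of `P_T4`**: `w₀ = τ₀|_{E⁺}` as a real embedding of `E⁺`. -/
def targetRealPlace (d : TargetData F E) : maximalRealSubfield E →+* ℝ :=
  realEmbeddingOfComplex d.τ₀

/-- `targetRealPlace d` agrees with `d.τ₀` on `E⁺`. -/
theorem coe_targetRealPlace (d : TargetData F E) (x : maximalRealSubfield E) :
    (targetRealPlace d x : ℂ) = d.τ₀ x :=
  coe_realEmbeddingOfComplex d.τ₀ x

/-- **The CM seesaw plane of a datum, definite at its distinguished place** `w₀ = τ₀|_{E⁺}`. -/
theorem isDefinite_isGenuineRow_ofLinesRow_cmQuad_target (d : TargetData F E) (ω : E) (hω : ω ≠ 0)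
    (h : IsCMField.complexConj E ω = -ω) (a b : maximalRealSubfield E) (ha : a ≠ 0) (hb : b ≠ 0)
    (hpos : (0 < (d.τ₀ a).re ∧ 0 < (d.τ₀ b).re) ∨ ((d.τ₀ a).re < 0 ∧ (d.τ₀ b).re < 0)) :
    IsDefinite (PlaneData.ofLinesRow (cmQuad ω h) a b 1) ∧ IsGenuineRow (PlaneData.ofLinesRow (cmQuad ω h) a b 1) :=
  isDefinite_isGenuineRow_ofLinesRow_cmQuad_at d.τ₀ ω hω h a b ha hb hpos

end Target

end Summit.Ventures.HodgeRepro.Tier4.Line1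

end
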